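import Mathlib
import Literature.Computability.AlgebraicComplexity.TensorApolarityForms
import Literature.Computability.AlgebraicComplexity.BorderApolarityWeak
import Literature.Computability.AlgebraicComplexity.BorderApolarityGeneric
import Literature.Computability.AlgebraicComplexity.GradedDegeneration
import Literature.Computability.AlgebraicComplexity.ApolarityGradedProducts
import Literature.Computability.AlgebraicComplexity.BorderRankMatMulTwoCert
import HarnessLib

/-!
# No `(110)`-candidate for `R̲(⟨2,2,2⟩) ≤ 6`: the torus-fixed classification behind
# Conner–Harper–Landsberg 2023, §5 (packaged form)

Topic `Literature/Computability/AlgebraicComplexity`. Theorems only. The tree proves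
`7 ≤ R̲(⟨2,2,2⟩)` in `BorderRankMatMulTwoApolarity.lean` (`MatMulTwo.seven_le_algBorderRank_matMulTensor_two`,
an inline assembly over `BorderApolarityTests/Perturb.lean` and `GradedInitialSubspace.lean`). This
sibling records the same argument through the PACKAGED toolkit `TensorApolarityForms.lean` /
`BorderApolarityWeak.lean` / `BorderApolarityGeneric.lean` / `GradedDegeneration.lean` /
`ApolarityGradedProducts.lean` (general 3-tensors, general torus weights), isolating the statement
that is actually checked in CHL 2023, §5 — "no `𝔹`-fixed six dimensional `F₁₁₀` … passes both the
`(210)` and `(120)` tests" — in its torus form and for ALL subspaces: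

* `MatMulTwo.mem_slicePerp_two_iff`, `MatMulTwo.isGraded_slicePerp` — `Y = M⟨2⟩(C*)^⊥` in
  coordinates and its gradedness for the separating one-parameter subgroup `(eA2, eB2)`;
* `MatMulTwo.wtPart_wc_eq`, `MatMulTwo.eq_sum_smul_wv`, `MatMulTwo.graded_le_span_wv` — the weight
  spaces of `Y` are the twelve lines `ω_k = MatMulTwo.wv k` (`BorderRankMatMulTwoCert.lean`), so a
  torus-fixed `G ⊆ Y` is spanned by the `ω_k` it contains (CHL §2.5, Fig. 1);
* `MatMulTwo.span_genSet_false_le`, `…true…` — the certificate's product sets lie in `G·A*`, `G·B*`;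
  `MatMulTwo.le_finrank_altA`, `…altB` — `dim Alt ≥ 24`;
* `MatMulTwo.not_exists_candidate` — **there is no subspace `F ⊆ Y` with `dim F ≥ 10`,
  `dim(F·A* + Alt) ≤ 58`, `dim(F·B* + Alt) ≤ 58`** (torus degeneration
  `exists_graded_degeneration` + the kernel-checked `MatMulTwo.rank_test_ge`). With
  `TensorApolarity.exists_subspace_of_algBorderRank_le` at `r = 6` this is `7 ≤ R̲(⟨2,2,2⟩)` again
  (not restated here).

## References

* A. Conner, A. Harper, J. M. Landsberg, *New lower bounds for matrix multiplication and `det₃`*,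
  Forum Math. Pi 11 (2023) e17 = arXiv:1911.07981, §2.5 (Fig. 1), §3, §4, §5. [ConnerHarperLandsberg2023]
* J. M. Landsberg, *The border rank of the multiplication of `2 × 2` matrices is seven*, J. Amer.
  Math. Soc. 19 (2006) 447–459. [Landsberg2005]
-/

noncomputable section

open Module
open scoped BigOperators Polynomial

namespace Literature.Computability.AlgebraicComplexity

namespace MatMulTwo

open TensorApolarity

variable {K : Type*} [Field K]

/-! ## `Y = M⟨2⟩(C*)^⊥` and its grading -/

/-- The pairing of a bilinear form with the `(i,k)`-slice of `⟨2,2,2⟩`: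
`∑_{p} v_p · ⟨2,2,2⟩_{(i,k),p} = v(X_{i0} ⊗ Y_{0k}) + v(X_{i1} ⊗ Y_{1k})`. [cite: ConnerHarperLandsberg2023, §4] -/
theorem sum_mul_matMulTensor_two (v : P2 × P2 → K) (i k : Fin 2) :
    ∑ p : P2 × P2, v p * matMulTensor K 2 2 2 (i, k) p.1 p.2 =
      v ((i, 0), (0, k)) + v ((i, 1), (1, k)) := by
  fin_cases i <;> fin_cases k <;>
    simp [Fintype.sum_prod_type, Fin.sum_univ_two, matMulTensor]

/-- **`Y = M⟨2⟩(C*)^⊥`** in coordinates: `v ∈ Y` iff `v(X_{i0} ⊗ Y_{0k}) + v(X_{i1} ⊗ Y_{1k}) = 0`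
for all `i, k` (`A* ⊗ B* = U ⊗ 𝔰𝔩(V)* ⊗ … `; CHL §4: `M(C*) = U* ⊗ Id_V ⊗ W`).
[cite: ConnerHarperLandsberg2023, §4] -/
theorem mem_slicePerp_two_iff {v : P2 × P2 → K} :
    v ∈ slicePerp (matMulTensor K 2 2 2) ↔
      ∀ i k : Fin 2, v ((i, 0), (0, k)) + v ((i, 1), (1, k)) = 0 := by
  simp only [mem_slicePerp, Prod.forall, sum_mul_matMulTensor_two]

/-- `Y` is graded for the one-parameter subgroup `(eA2, eB2)` (it is a sub-`G`-module).
[cite: ConnerHarperLandsberg2023, §4] -/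
theorem isGraded_slicePerp :
    GradedLimit.IsGraded (wt₁ eA2 eB2) (slicePerp (matMulTensor K 2 2 2)) := by
  intro n v hv
  rw [mem_slicePerp_two_iff] at hv ⊢
  intro i k
  have he : eA2 (i, 0) + eB2 (0, k) = eA2 (i, 1) + eB2 (1, k) := by
    fin_cases i <;> fin_cases k <;> decide
  simp only [GradedLimit.wtPart_apply, wt₁_apply, ← he]
  split_ifs <;> simp [hv i k]

/-! ## The twelve weight lines -/

/-- The weight-`wc k` component of a form in `Y` is its pivot coordinate times the weight line
`ω_k` (the weight spaces of `Y` are the lines `ω_k`). [cite: ConnerHarperLandsberg2023, §5 (Fig. 1)] -/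
theorem wtPart_wc_eq {v : P2 × P2 → K} (hv : v ∈ slicePerp (matMulTensor K 2 2 2)) (k : Fin 12) :
    GradedLimit.wtPart (wt₁ eA2 eB2) (wc k) v = v (piv k) • wv K k := by
  rw [mem_slicePerp_two_iff] at hv
  have h00 : v ((0, 1), (1, 0)) = -v ((0, 0), (0, 0)) := eq_neg_of_add_eq_zero_right (hv 0 0)
  have h01 : v ((0, 1), (1, 1)) = -v ((0, 0), (0, 1)) := eq_neg_of_add_eq_zero_right (hv 0 1)
  have h10 : v ((1, 1), (1, 0)) = -v ((1, 0), (0, 0)) := eq_neg_of_add_eq_zero_right (hv 1 0)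
  have h11 : v ((1, 1), (1, 1)) = -v ((1, 0), (0, 1)) := eq_neg_of_add_eq_zero_right (hv 1 1)
  funext ⟨⟨a, b⟩, ⟨c, d⟩⟩
  fin_cases k <;> fin_cases a <;> fin_cases b <;> fin_cases c <;> fin_cases d <;>
    simp [wv, wvZ, encS, encP, wc, piv, eA2, eB2, h00, h01, h10, h11]

/-- The weights of the sixteen coordinates are exactly the twelve (distinct) weights `wc k`.
[cite: ConnerHarperLandsberg2023, §5 (Fig. 1)] -/
theorem image_wt₁_eq_image_wc :
    (Finset.univ : Finset (P2 × P2)).image (wt₁ eA2 eB2) = (Finset.univ : Finset (Fin 12)).image wc := by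
  decide

/-- The twelve weights are pairwise distinct. [cite: ConnerHarperLandsberg2023, §5 (Fig. 1)] -/
theorem wc_injective : Function.Injective wc := by
  decide

/-- A form in `Y` is the combination `∑_k v(piv k) ω_k` of the weight lines.
[cite: ConnerHarperLandsberg2023, §5 (Fig. 1)] -/
theorem eq_sum_smul_wv {v : P2 × P2 → K} (hv : v ∈ slicePerp (matMulTensor K 2 2 2)) :
    v = ∑ k : Fin 12, v (piv k) • wv K k := by
  calc v = ∑ n ∈ (Finset.univ : Finset (P2 × P2)).image (wt₁ eA2 eB2),
        GradedLimit.wtPart (wt₁ eA2 eB2) n v := (GradedLimit.sum_wtPart _ v).symm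
    _ = ∑ n ∈ (Finset.univ : Finset (Fin 12)).image wc, GradedLimit.wtPart (wt₁ eA2 eB2) n v := by
        rw [image_wt₁_eq_image_wc]
    _ = ∑ k : Fin 12, GradedLimit.wtPart (wt₁ eA2 eB2) (wc k) v :=
        Finset.sum_image fun a _ b _ h => wc_injective h
    _ = ∑ k : Fin 12, v (piv k) • wv K k := Finset.sum_congr rfl fun k _ => wtPart_wc_eq hv k

/-- **Torus-fixed candidates are coordinate**: a graded subspace of `Y` is spanned by the weight
lines it contains ("the `𝔹`-fixed subspaces … are just wedge products of choices of subsets of the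
weight vectors", CHL §2.5, here for the torus). [cite: ConnerHarperLandsberg2023, §2.5] -/
theorem graded_le_span_wv {G : Submodule K (P2 × P2 → K)}
    (hG : GradedLimit.IsGraded (wt₁ eA2 eB2) G) (hGY : G ≤ slicePerp (matMulTensor K 2 2 2))
    (S : Finset (Fin 12)) (hS : ∀ k, wv K k ∈ G → k ∈ S) :
    G ≤ Submodule.span K (wv K '' (S : Set (Fin 12))) := by
  intro v hv
  rw [eq_sum_smul_wv (hGY hv)]
  refine Submodule.sum_mem _ fun k _ => ?_
  by_cases h0 : v (piv k) = 0
  · simp [h0]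
  · have hk : wv K k ∈ G := by
      have hpart : v (piv k) • wv K k ∈ G := wtPart_wc_eq (hGY hv) k ▸ hG (wc k) v hv
      have := G.smul_mem (v (piv k))⁻¹ hpart
      rwa [smul_smul, inv_mul_cancel₀ h0, one_smul] at this
    exact Submodule.smul_mem _ _ (Submodule.subset_span ⟨k, hS k hk, rfl⟩)

/-! ## From the certificate's product sets to `prodA`, `prodB` -/

/-- `MatMulTwo.mul210Fun a₀ φ = φ · e_{a₀}`. [cite: ConnerHarperLandsberg2023, §3 (the (210)-map)] -/
theorem mul210Fun_eq_mulA (a₀ : P2) (φ : P2 × P2 → K) :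
    mul210Fun K a₀ φ = mulA φ (Pi.single a₀ 1) := by
  funext ⟨a, a', b⟩
  simp only [mul210Fun, mulA_apply, Pi.single_apply, mul_ite, mul_one, mul_zero]

/-- `MatMulTwo.mul120Fun b₀ φ = φ · e_{b₀}`. [cite: ConnerHarperLandsberg2023, §3 (the (120)-map)] -/
theorem mul120Fun_eq_mulB (b₀ : P2) (φ : P2 × P2 → K) :
    mul120Fun K b₀ φ = mulB φ (Pi.single b₀ 1) := by
  funext ⟨a, b, b'⟩
  simp only [mul120Fun, mulB_apply, Pi.single_apply, mul_ite, mul_one, mul_zero]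

/-- The `(210)` test products of `S` lie in `span{ω_k : k ∈ S} · A*`. [cite: ConnerHarperLandsberg2023, §3] -/
theorem span_genSet_false_le (S : Finset (Fin 12)) :
    Submodule.span K (genSet K false S) ≤ prodA (Submodule.span K (wv K '' (S : Set (Fin 12)))) := by
  refine Submodule.span_le.2 ?_
  rintro _ ⟨k, hk, b, rfl⟩
  have : rowFun K false k b = mulA (wv K k) (Pi.single b 1) := by
    funext t
    simp [rowFun, mul210Fun_eq_mulA]
  rw [this]
  have hk' : wv K k ∈ Submodule.span K (wv K '' (S : Set (Fin 12))) :=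
    Submodule.subset_span ⟨k, hk, rfl⟩
  exact mulA_single_mem_prodA hk' b

/-- The `(120)` test products of `S` lie in `span{ω_k : k ∈ S} · B*`. [cite: ConnerHarperLandsberg2023, §3] -/
theorem span_genSet_true_le (S : Finset (Fin 12)) :
    Submodule.span K (genSet K true S) ≤ prodB (Submodule.span K (wv K '' (S : Set (Fin 12)))) := by
  refine Submodule.span_le.2 ?_
  rintro _ ⟨k, hk, b, rfl⟩
  have : rowFun K true k b = mulB (wv K k) (Pi.single b 1) := by
    funext t
    simp [rowFun, mul120Fun_eq_mulB]
  rw [this]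
  have hk' : wv K k ∈ Submodule.span K (wv K '' (S : Set (Fin 12))) :=
    Submodule.subset_span ⟨k, hk, rfl⟩
  exact mulB_single_mem_prodB hk' b

/-! ## `dim Alt = 24` -/

/-- The six increasing pairs of `A*`- (or `B*`-) coordinates, for `dim Alt = 6 · 4`. [folklore] -/
theorem pairs_spec :
    let pr : Fin 6 → P2 × P2 := ![((0, 0), (0, 1)), ((0, 0), (1, 0)), ((0, 0), (1, 1)),
      ((0, 1), (1, 0)), ((0, 1), (1, 1)), ((1, 0), (1, 1))]
    (∀ i j, pr i = pr j → i = j) ∧ (∀ i j, ((pr i).2, (pr i).1) ≠ pr j) ∧ ∀ i, (pr i).1 ≠ (pr i).2 := by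
  decide

/-- **`dim Alt ≥ 24`** for the alternating `(2,1,0)` arrays of `⟨2,2,2⟩` (in fact `= 24 = C(4,2)·4`).
[folklore] -/
theorem le_finrank_altA : 24 ≤ finrank K (altA K P2 P2) := by
  classical
  let pr : Fin 6 → P2 × P2 := ![((0, 0), (0, 1)), ((0, 0), (1, 0)), ((0, 0), (1, 1)),
    ((0, 1), (1, 0)), ((0, 1), (1, 1)), ((1, 0), (1, 1))]
  obtain ⟨hinj, hswap, hne⟩ : (∀ i j, pr i = pr j → i = j) ∧ (∀ i j, ((pr i).2, (pr i).1) ≠ pr j) ∧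
      ∀ i, (pr i).1 ≠ (pr i).2 := pairs_spec
  -- `c ↦ ∑_i (c(i,m) on (pr i, m)) − (c(i,m) on (swap pr i, m))`
  let ψ : (Fin 6 × P2 → K) →ₗ[K] (P2 × (P2 × P2) → K) :=
    { toFun := fun c p => ∑ i, ((if (p.1, p.2.1) = pr i then c (i, p.2.2) else 0) -
        (if (p.2.1, p.1) = pr i then c (i, p.2.2) else 0))
      map_add' := fun c c' => by
        funext p
        simp only [Pi.add_apply, ← Finset.sum_add_distrib]
        refine Finset.sum_congr rfl fun i _ => ?_
        split_ifs <;> ring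
      map_smul' := fun a c => by
        funext p
        simp only [Pi.smul_apply, smul_eq_mul, RingHom.id_apply, Finset.mul_sum]
        refine Finset.sum_congr rfl fun i _ => ?_
        split_ifs <;> ring }
  have hψ : ∀ c k k' m, ψ c (k, (k', m)) = ∑ i, ((if (k, k') = pr i then c (i, m) else 0) -
      (if (k', k) = pr i then c (i, m) else 0)) := fun _ _ _ _ => rfl
  have hrange : LinearMap.range ψ ≤ altA K P2 P2 := by
    rintro _ ⟨c, rfl⟩
    refine ⟨fun k k' m => ?_, fun k m => ?_⟩
    · rw [hψ, hψ, ← Finset.sum_neg_distrib]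
      refine Finset.sum_congr rfl fun i _ => ?_
      ring
    · rw [hψ]
      exact Finset.sum_eq_zero fun i _ => sub_self _
  have hval : ∀ c i m, ψ c ((pr i).1, ((pr i).2, m)) = c (i, m) := by
    intro c i m
    rw [hψ, Finset.sum_eq_single i]
    · rw [Prod.mk.eta, if_pos rfl, if_neg (hswap i i), sub_zero]
    · intro j _ hji
      rw [Prod.mk.eta, if_neg (fun h => hji (hinj _ _ h).symm), if_neg (hswap i j), sub_zero]
    · intro h
      exact absurd (Finset.mem_univ i) h
  have hinjψ : Function.Injective ψ := by
    rw [← LinearMap.ker_eq_bot, LinearMap.ker_eq_bot']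
    intro c hc
    funext ⟨i, m⟩
    have := congrFun hc ((pr i).1, ((pr i).2, m))
    rwa [hval] at this
  calc 24 = finrank K (Fin 6 × P2 → K) := by simp
    _ = finrank K (LinearMap.range ψ) := (LinearMap.finrank_range_of_inj hinjψ).symm
    _ ≤ finrank K (altA K P2 P2) := Submodule.finrank_mono hrange

/-- **`dim Alt ≥ 24`** for the alternating `(1,2,0)` arrays. [folklore] -/
theorem le_finrank_altB : 24 ≤ finrank K (altB K P2 P2) := by
  classical
  let pr : Fin 6 → P2 × P2 := ![((0, 0), (0, 1)), ((0, 0), (1, 0)), ((0, 0), (1, 1)),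
    ((0, 1), (1, 0)), ((0, 1), (1, 1)), ((1, 0), (1, 1))]
  obtain ⟨hinj, hswap, hne⟩ : (∀ i j, pr i = pr j → i = j) ∧ (∀ i j, ((pr i).2, (pr i).1) ≠ pr j) ∧
      ∀ i, (pr i).1 ≠ (pr i).2 := pairs_spec
  let ψ : (Fin 6 × P2 → K) →ₗ[K] (P2 × (P2 × P2) → K) :=
    { toFun := fun c p => ∑ i, ((if (p.2.1, p.2.2) = pr i then c (i, p.1) else 0) -
        (if (p.2.2, p.2.1) = pr i then c (i, p.1) else 0))
      map_add' := fun c c' => by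
        funext p
        simp only [Pi.add_apply, ← Finset.sum_add_distrib]
        refine Finset.sum_congr rfl fun i _ => ?_
        split_ifs <;> ring
      map_smul' := fun a c => by
        funext p
        simp only [Pi.smul_apply, smul_eq_mul, RingHom.id_apply, Finset.mul_sum]
        refine Finset.sum_congr rfl fun i _ => ?_
        split_ifs <;> ring }
  have hψ : ∀ c k m m', ψ c (k, (m, m')) = ∑ i, ((if (m, m') = pr i then c (i, k) else 0) -
      (if (m', m) = pr i then c (i, k) else 0)) := fun _ _ _ _ => rfl
  have hrange : LinearMap.range ψ ≤ altB K P2 P2 := by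
    rintro _ ⟨c, rfl⟩
    refine ⟨fun k m m' => ?_, fun k m => ?_⟩
    · rw [hψ, hψ, ← Finset.sum_neg_distrib]
      refine Finset.sum_congr rfl fun i _ => ?_
      ring
    · rw [hψ]
      exact Finset.sum_eq_zero fun i _ => sub_self _
  have hval : ∀ c i k, ψ c (k, ((pr i).1, (pr i).2)) = c (i, k) := by
    intro c i k
    rw [hψ, Finset.sum_eq_single i]
    · rw [Prod.mk.eta, if_pos rfl, if_neg (hswap i i), sub_zero]
    · intro j _ hji
      rw [Prod.mk.eta, if_neg (fun h => hji (hinj _ _ h).symm), if_neg (hswap i j), sub_zero]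
    · intro h
      exact absurd (Finset.mem_univ i) h
  have hinjψ : Function.Injective ψ := by
    rw [← LinearMap.ker_eq_bot, LinearMap.ker_eq_bot']
    intro c hc
    funext ⟨i, k⟩
    have := congrFun hc (k, ((pr i).1, (pr i).2))
    rwa [hval] at this
  calc 24 = finrank K (Fin 6 × P2 → K) := by simp
    _ = finrank K (LinearMap.range ψ) := (LinearMap.finrank_range_of_inj hinjψ).symm
    _ ≤ finrank K (altB K P2 P2) := Submodule.finrank_mono hrange

/-! ## The main theorem -/

/-- **No torus-fixed, hence no, `(110)`-candidate for `r = 6`**: there is no subspace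
`F ⊆ Y = M⟨2⟩(C*)^⊥` with `dim F ≥ 10`, `dim(F·A* + Alt) ≤ 58` and `dim(F·B* + Alt) ≤ 58`
(CHL 2023, §5, for all torus-fixed candidates via `rank_test_ge`, and for all candidates by the
torus degeneration `exists_graded_degeneration`). [cite: ConnerHarperLandsberg2023, §5] -/
theorem not_exists_candidate [CharZero K] :
    ¬ ∃ F : Submodule K (P2 × P2 → K), F ≤ slicePerp (matMulTensor K 2 2 2) ∧
      10 ≤ finrank K F ∧ finrank K ↥(prodA F ⊔ altA K P2 P2) ≤ 58 ∧
      finrank K ↥(prodB F ⊔ altB K P2 P2) ≤ 58 := by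
  classical
  rintro ⟨F, hFY, hF10, hFA, hFB⟩
  -- torus degeneration to a graded candidate
  obtain ⟨G, hGY, hG, hG10, hGA, hGB⟩ :=
    exists_graded_degeneration eA2 eB2 isGraded_slicePerp hFY hF10 hFA hFB
  -- which is spanned by the weight lines it contains
  set S : Finset (Fin 12) := Finset.univ.filter fun k => wv K k ∈ G with hSdef
  have hGS : G ≤ Submodule.span K (wv K '' (S : Set (Fin 12))) :=
    graded_le_span_wv hG hGY S fun k hk => by simp [hSdef, hk]
  have hSG : Submodule.span K (wv K '' (S : Set (Fin 12))) ≤ G := by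
    refine Submodule.span_le.2 ?_
    rintro _ ⟨k, hk, rfl⟩
    exact (Finset.mem_filter.1 hk).2
  have hS10 : 10 ≤ S.card := by
    calc 10 ≤ finrank K G := hG10
      _ ≤ finrank K (Submodule.span K (wv K '' (S : Set (Fin 12)))) := Submodule.finrank_mono hGS
      _ ≤ (S.image (wv K)).card := by
          rw [← Finset.coe_image]
          exact finrank_span_finset_le_card _
      _ ≤ S.card := Finset.card_image_le
  -- every such set of weight lines fails a test
  rcases rank_test_ge K S hS10 with hA | hB
  · have h59 : 59 ≤ finrank K ↥(prodA G ⊔ altA K P2 P2) := by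
      calc 59 ≤ finrank K (prodA (Submodule.span K (wv K '' (S : Set (Fin 12))))) +
            finrank K (altA K P2 P2) :=
            add_le_add (hA.trans (Submodule.finrank_mono (span_genSet_false_le S))) le_finrank_altA
        _ = finrank K ↥(prodA (Submodule.span K (wv K '' (S : Set (Fin 12)))) ⊔ altA K P2 P2) := by
            rw [← Submodule.finrank_sup_add_finrank_inf_eq, prodA_inf_altA_eq_bot, finrank_bot,
              add_zero]
        _ ≤ finrank K ↥(prodA G ⊔ altA K P2 P2) :=
            Submodule.finrank_mono (sup_le_sup_right (prodA_mono hSG) _)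
    exact absurd (le_trans h59 hGA) (by norm_num)
  · have h59 : 59 ≤ finrank K ↥(prodB G ⊔ altB K P2 P2) := by
      calc 59 ≤ finrank K (prodB (Submodule.span K (wv K '' (S : Set (Fin 12))))) +
            finrank K (altB K P2 P2) :=
            add_le_add (hB.trans (Submodule.finrank_mono (span_genSet_true_le S))) le_finrank_altB
        _ = finrank K ↥(prodB (Submodule.span K (wv K '' (S : Set (Fin 12)))) ⊔ altB K P2 P2) := by
            rw [← Submodule.finrank_sup_add_finrank_inf_eq, prodB_inf_altB_eq_bot, finrank_bot,
              add_zero]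
        _ ≤ finrank K ↥(prodB G ⊔ altB K P2 P2) :=
            Submodule.finrank_mono (sup_le_sup_right (prodB_mono hSG) _)
    exact absurd (le_trans h59 hGB) (by norm_num)

end MatMulTwo

end Literature.Computability.AlgebraicComplexity

end
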